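import Summits.Schanuel.Schanuel.Theorems.RootDecomp1KOnePointCell01

/-!
# RootDecomp1KOnePointCell — lens 1, generation 39 «ONE-POINT ZERO ESTIMATE + LOG-LOG WALL CELL of 33364» ((1, ℓ₂, ℓ₃, ρ) for every log-log-Liouville ρ) — continuation (RootDecomp1KOnePointCell02): §2 (T) Taylor re-centring tools on `ℤ[x][y]` (section `Taylor`)

(lens-1 g39 `RootDecomp1KOnePointCell.lean` [HOME/decomp-schanuel-lens-1/g39/RootDecomp1KOnePointCell.lean sha256 4a1f4bc8…4211, 2530 l + OPprobe + OPctrl + NODE-g39.md; NOTE/CLAIM L1801, ACK + CHECKLIST K-g39 L1803, presearch (6) resolved by the critic L1810, NODE L1824 / REQUEST L1825 / RESULT L1826]; port by census-1 gen 16 in ten parts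
`RootDecomp1KOnePointCell01`–`10` — see the PORT NOTE of part 01; `--supports stmt-Schanuel-33364`; rung 0.)
-/

open Complex IntermediateField Polynomial
open Summit.Schanuel.Schanuel.Theorems.RootDecomp1KHyper
open Summit.Schanuel.Schanuel.Theorems.RootDecomp1KHyper.HyperCell
open Summit.Schanuel.Schanuel.Theorems.RootDecomp1KGeneric
open Summit.Schanuel.Schanuel.Theorems.RootDecomp1KRelLiouvilleCell
open Summit.Schanuel.Schanuel.Theorems.RootDecomp1KLogLogCell
open Summit.Schanuel.Schanuel.Theorems.RootDecomp1KTwoBaseCell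
open Summit.Schanuel.Schanuel.Theorems.RootDecomp1KMeasuredWallCell

namespace Summit.Schanuel.Schanuel.Theorems.RootDecomp1KOnePointCell

/-! ## §2  (T) TAYLOR RE-CENTRING TOOLS on `ℤ[x][y]` (outer variable `y`, inner variable `x`) -/

section Taylor
open scoped Nat

variable {R : Type*} [CommRing R]

/-- `(taylor r f)_k = Σ_{i < natDegree f + 1} C(i+k, k) f_{i+k} rⁱ`. -/
theorem taylor_coeff_eq_sum (f : R[X]) (r : R) (k : ℕ) :
    (taylor r f).coeff k =
      ∑ i ∈ Finset.range (f.natDegree + 1), (((i + k).choose k : ℕ) : R) * f.coeff (i + k) * r ^ i := by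
  have hlt : (hasseDeriv k f).natDegree < f.natDegree + 1 :=
    lt_of_le_of_lt ((natDegree_hasseDeriv_le f k).trans (Nat.sub_le _ _)) (Nat.lt_succ_self _)
  rw [taylor_coeff, eval_eq_sum_range' hlt]
  refine Finset.sum_congr rfl fun i _ => ?_
  rw [hasseDeriv_coeff]

/-- **Height of an inner Taylor shift** (`A ∈ ℤ`, `|A| ≤ α`, `α ≥ 1`): for `f ∈ ℤ[x]` of degree `≤ d` and
height `≤ L`, `|(taylor A f)_k| ≤ (d+1)·2^d·α^d·L`. -/
theorem abs_coeff_taylor_le (f : ℤ[X]) {d : ℕ} (hdeg : f.natDegree ≤ d) {L : ℤ}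
    (hcoef : ∀ j, |f.coeff j| ≤ L) {A α : ℤ} (hA : |A| ≤ α) (hα : 1 ≤ α) (k : ℕ) :
    |(taylor A f).coeff k| ≤ (d + 1) * 2 ^ d * α ^ d * L := by
  have hL0 : 0 ≤ L := (abs_nonneg _).trans (hcoef 0)
  have hα0 : 0 ≤ α := by linarith
  have hX0 : (0 : ℤ) ≤ 2 ^ d * α ^ d * L := mul_nonneg (mul_nonneg (pow_nonneg (by norm_num) d)
    (pow_nonneg hα0 d)) hL0
  rw [taylor_coeff_eq_sum]
  calc |∑ i ∈ Finset.range (f.natDegree + 1), (((i + k).choose k : ℕ) : ℤ) * f.coeff (i + k) * A ^ i|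
      ≤ ∑ i ∈ Finset.range (f.natDegree + 1), |(((i + k).choose k : ℕ) : ℤ) * f.coeff (i + k) * A ^ i| :=
        Finset.abs_sum_le_sum_abs _ _
    _ ≤ ∑ _i ∈ Finset.range (f.natDegree + 1), 2 ^ d * α ^ d * L := by
        refine Finset.sum_le_sum fun i hi => ?_
        have hi' : i ≤ d := by have := Finset.mem_range.mp hi; omega
        by_cases hik : i + k ≤ d
        · rw [abs_mul, abs_mul, abs_pow, Nat.abs_cast]
          have h1 : (((i + k).choose k : ℕ) : ℤ) ≤ 2 ^ d := by
            calc (((i + k).choose k : ℕ) : ℤ) ≤ ((2 ^ (i + k) : ℕ) : ℤ) := by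
                  exact_mod_cast Nat.choose_le_two_pow _ _
              _ ≤ 2 ^ d := by push_cast; exact pow_le_pow_right₀ (by norm_num) hik
          have h2 : |A| ^ i ≤ α ^ d :=
            (pow_le_pow_left₀ (abs_nonneg _) hA i).trans (pow_le_pow_right₀ hα hi')
          have h3 := hcoef (i + k)
          calc (((i + k).choose k : ℕ) : ℤ) * |f.coeff (i + k)| * |A| ^ i
              ≤ 2 ^ d * L * α ^ d :=
                mul_le_mul (mul_le_mul h1 h3 (abs_nonneg _) (by positivity)) h2 (by positivity)
                  (mul_nonneg (by positivity) hL0)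
            _ = 2 ^ d * α ^ d * L := by ring
        · have h0 : f.coeff (i + k) = 0 := coeff_eq_zero_of_natDegree_lt (by omega)
          rw [h0, mul_zero, zero_mul, abs_zero]; exact hX0
    _ = ((f.natDegree + 1 : ℕ) : ℤ) * (2 ^ d * α ^ d * L) := by
        rw [Finset.sum_const, Finset.card_range, nsmul_eq_mul]
    _ ≤ ((d : ℤ) + 1) * (2 ^ d * α ^ d * L) := by
        refine mul_le_mul_of_nonneg_right ?_ hX0
        exact_mod_cast Nat.succ_le_succ hdeg
    _ = (d + 1) * 2 ^ d * α ^ d * L := by ring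

/-- Inner coefficients of an OUTER Taylor shift: `((taylor (C B) H)_b)_j = Σ_i C(i+b, b) (H_{i+b})_j Bⁱ`. -/
theorem coeff_coeff_taylor_C (H : ℤ[X][X]) (B : ℤ) (b j : ℕ) :
    ((taylor (C B) H).coeff b).coeff j =
      ∑ i ∈ Finset.range (H.natDegree + 1),
        (((i + b).choose b : ℕ) : ℤ) * (H.coeff (i + b)).coeff j * B ^ i := by
  rw [taylor_coeff_eq_sum, finsetSum_coeff]
  refine Finset.sum_congr rfl fun i _ => ?_
  rw [← C_pow, coeff_mul_C, ← Polynomial.C_eq_natCast, coeff_C_mul]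

/-- An outer Taylor shift keeps the inner degrees `≤ d`. -/
theorem natDegree_coeff_taylor_C_le (H : ℤ[X][X]) {d : ℕ} (hdegx : ∀ i, (H.coeff i).natDegree ≤ d)
    (B : ℤ) (b : ℕ) : ((taylor (C B) H).coeff b).natDegree ≤ d := by
  rw [natDegree_le_iff_coeff_eq_zero]
  intro j hj
  rw [coeff_coeff_taylor_C]
  refine Finset.sum_eq_zero fun i _ => ?_
  rw [coeff_eq_zero_of_natDegree_lt (lt_of_le_of_lt (hdegx (i + b)) hj), mul_zero, zero_mul]

/-- **Height of an outer Taylor shift** (`B ∈ ℤ`, `|B| ≤ β`, `β ≥ 1`): for `H ∈ ℤ[x][y]` of `y`-degree `≤ d`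
and height `≤ L`, `|((taylor (C B) H)_b)_j| ≤ (d+1)·2^d·β^d·L`. -/
theorem abs_coeff_coeff_taylor_C_le (H : ℤ[X][X]) {d : ℕ} (hdeg : H.natDegree ≤ d) {L : ℤ}
    (hcoef : ∀ i j, |(H.coeff i).coeff j| ≤ L) {B β : ℤ} (hB : |B| ≤ β) (hβ : 1 ≤ β) (b j : ℕ) :
    |((taylor (C B) H).coeff b).coeff j| ≤ (d + 1) * 2 ^ d * β ^ d * L := by
  have hL0 : 0 ≤ L := (abs_nonneg _).trans (hcoef 0 0)
  have hβ0 : 0 ≤ β := by linarith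
  have hX0 : (0 : ℤ) ≤ 2 ^ d * β ^ d * L := mul_nonneg (mul_nonneg (pow_nonneg (by norm_num) d)
    (pow_nonneg hβ0 d)) hL0
  rw [coeff_coeff_taylor_C]
  calc |∑ i ∈ Finset.range (H.natDegree + 1),
        (((i + b).choose b : ℕ) : ℤ) * (H.coeff (i + b)).coeff j * B ^ i|
      ≤ ∑ i ∈ Finset.range (H.natDegree + 1),
          |(((i + b).choose b : ℕ) : ℤ) * (H.coeff (i + b)).coeff j * B ^ i| :=
        Finset.abs_sum_le_sum_abs _ _
    _ ≤ ∑ _i ∈ Finset.range (H.natDegree + 1), 2 ^ d * β ^ d * L := by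
        refine Finset.sum_le_sum fun i hi => ?_
        have hi' : i ≤ d := by have := Finset.mem_range.mp hi; omega
        by_cases hib : i + b ≤ d
        · rw [abs_mul, abs_mul, abs_pow, Nat.abs_cast]
          have h1 : (((i + b).choose b : ℕ) : ℤ) ≤ 2 ^ d := by
            calc (((i + b).choose b : ℕ) : ℤ) ≤ ((2 ^ (i + b) : ℕ) : ℤ) := by
                  exact_mod_cast Nat.choose_le_two_pow _ _
              _ ≤ 2 ^ d := by push_cast; exact pow_le_pow_right₀ (by norm_num) hib
          have h2 : |B| ^ i ≤ β ^ d :=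
            (pow_le_pow_left₀ (abs_nonneg _) hB i).trans (pow_le_pow_right₀ hβ hi')
          have h3 := hcoef (i + b) j
          calc (((i + b).choose b : ℕ) : ℤ) * |(H.coeff (i + b)).coeff j| * |B| ^ i
              ≤ 2 ^ d * L * β ^ d :=
                mul_le_mul (mul_le_mul h1 h3 (abs_nonneg _) (by positivity)) h2 (by positivity)
                  (mul_nonneg (by positivity) hL0)
            _ = 2 ^ d * β ^ d * L := by ring
        · have h0 : H.coeff (i + b) = 0 := coeff_eq_zero_of_natDegree_lt (by omega)
          rw [h0, coeff_zero, mul_zero, zero_mul, abs_zero]; exact hX0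
    _ = ((H.natDegree + 1 : ℕ) : ℤ) * (2 ^ d * β ^ d * L) := by
        rw [Finset.sum_const, Finset.card_range, nsmul_eq_mul]
    _ ≤ ((d : ℤ) + 1) * (2 ^ d * β ^ d * L) := by
        refine mul_le_mul_of_nonneg_right ?_ hX0
        exact_mod_cast Nat.succ_le_succ hdeg
    _ = (d + 1) * 2 ^ d * β ^ d * L := by ring

/-- `evxy` over a fixed box: `F(x₀, y₀) = Σ_{i ≤ d} Σ_{j ≤ d} F_{ij} x₀^j y₀^i` when the partial degrees are `≤ d`. -/
theorem evxy_eq_sum_sum (x₀ y₀ : ℚ) (F : ℤ[X][X]) {d : ℕ} (hdegy : F.natDegree ≤ d)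
    (hdegx : ∀ i, (F.coeff i).natDegree ≤ d) :
    evxy x₀ y₀ F = ∑ i ∈ Finset.range (d + 1), ∑ j ∈ Finset.range (d + 1),
      (((F.coeff i).coeff j : ℤ) : ℚ) * x₀ ^ j * y₀ ^ i := by
  unfold evxy
  have hlt : (F.map (Polynomial.aeval x₀ : ℤ[X] →ₐ[ℤ] ℚ).toRingHom).natDegree < d + 1 :=
    lt_of_le_of_lt ((natDegree_map_le).trans hdegy) (Nat.lt_succ_self d)
  rw [eval_eq_sum_range' hlt]
  refine Finset.sum_congr rfl fun i _ => ?_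
  rw [coeff_map]
  have hin : ((Polynomial.aeval x₀ : ℤ[X] →ₐ[ℤ] ℚ).toRingHom (F.coeff i) : ℚ) =
      ∑ j ∈ Finset.range (d + 1), (((F.coeff i).coeff j : ℤ) : ℚ) * x₀ ^ j := by
    show Polynomial.aeval x₀ (F.coeff i) = _
    rw [Polynomial.aeval_def, eval₂_eq_sum_range' (algebraMap ℤ ℚ)
      (lt_of_le_of_lt (hdegx i) (Nat.lt_succ_self d))]
    refine Finset.sum_congr rfl fun j _ => ?_
    rw [algebraMap_int_eq, eq_intCast]
  rw [hin, Finset.sum_mul]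

/-- One row of the rescaled polynomial: `Σ_{j ≤ d} F_{ij} s^{d−j} t^{d−i} X^j`. -/
noncomputable def scaleRow (F : ℤ[X][X]) (s t : ℤ) (d i : ℕ) : ℤ[X] :=
  ∑ j ∈ Finset.range (d + 1), monomial j ((F.coeff i).coeff j * s ^ (d - j) * t ^ (d - i))

/-- **The rescaled polynomial** `F̃(X, Y) = Σ_{i,j ≤ d} F_{ij} s^{d−j} t^{d−i} X^j Y^i (= s^d t^d F(X/s, Y/t))`. -/
noncomputable def scaleXY (F : ℤ[X][X]) (s t : ℤ) (d : ℕ) : ℤ[X][X] :=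
  ∑ i ∈ Finset.range (d + 1), monomial i (scaleRow F s t d i)

/-- Coefficients of a row. -/
theorem coeff_scaleRow (F : ℤ[X][X]) (s t : ℤ) (d i j : ℕ) :
    (scaleRow F s t d i).coeff j =
      if j ∈ Finset.range (d + 1) then (F.coeff i).coeff j * s ^ (d - j) * t ^ (d - i) else 0 := by
  classical
  unfold scaleRow
  simp only [finsetSum_coeff, coeff_monomial]
  rw [Finset.sum_ite_eq']

/-- Rows of the rescaled polynomial. -/
theorem coeff_scaleXY (F : ℤ[X][X]) (s t : ℤ) (d i : ℕ) :
    (scaleXY F s t d).coeff i = if i ∈ Finset.range (d + 1) then scaleRow F s t d i else 0 := by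
  classical
  unfold scaleXY
  simp only [finsetSum_coeff, coeff_monomial]
  rw [Finset.sum_ite_eq']

/-- Coefficients of the rescaled polynomial. -/
theorem coeff_coeff_scaleXY (F : ℤ[X][X]) (s t : ℤ) (d i j : ℕ) :
    ((scaleXY F s t d).coeff i).coeff j =
      if i ≤ d ∧ j ≤ d then (F.coeff i).coeff j * s ^ (d - j) * t ^ (d - i) else 0 := by
  rw [coeff_scaleXY]
  by_cases hi : i ≤ d
  · rw [if_pos (Finset.mem_range.mpr (by omega)), coeff_scaleRow]
    by_cases hj : j ≤ d
    · rw [if_pos (Finset.mem_range.mpr (by omega)), if_pos ⟨hi, hj⟩]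
    · rw [if_neg (fun h => hj (by have := Finset.mem_range.mp h; omega)), if_neg (fun h => hj h.2)]
  · rw [if_neg (fun h => hi (by have := Finset.mem_range.mp h; omega)), if_neg (fun h => hi h.1),
      coeff_zero]

/-- Outer degree of the rescaled polynomial. -/
theorem natDegree_scaleXY_le (F : ℤ[X][X]) (s t : ℤ) (d : ℕ) : (scaleXY F s t d).natDegree ≤ d := by
  rw [natDegree_le_iff_coeff_eq_zero]
  intro i hi
  ext j
  rw [coeff_coeff_scaleXY, if_neg (fun h => absurd h.1 (by omega)), coeff_zero]

/-- Inner degrees of the rescaled polynomial. -/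
theorem natDegree_coeff_scaleXY_le (F : ℤ[X][X]) (s t : ℤ) (d i : ℕ) :
    ((scaleXY F s t d).coeff i).natDegree ≤ d := by
  rw [natDegree_le_iff_coeff_eq_zero]
  intro j hj
  rw [coeff_coeff_scaleXY, if_neg (fun h => absurd h.2 (by omega))]

/-- Height of the rescaled polynomial (`s, t ≥ 1`). -/
theorem abs_coeff_coeff_scaleXY_le (F : ℤ[X][X]) {s t : ℤ} (hs : 1 ≤ s) (ht : 1 ≤ t) (d : ℕ) {L : ℤ}
    (hcoef : ∀ i j, |(F.coeff i).coeff j| ≤ L) (i j : ℕ) :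
    |((scaleXY F s t d).coeff i).coeff j| ≤ L * s ^ d * t ^ d := by
  have hL0 : 0 ≤ L := (abs_nonneg _).trans (hcoef 0 0)
  have hs0 : 0 ≤ s := by linarith
  have ht0 : 0 ≤ t := by linarith
  rw [coeff_coeff_scaleXY]
  split_ifs with h
  · rw [abs_mul, abs_mul, abs_pow, abs_pow, abs_of_nonneg hs0, abs_of_nonneg ht0]
    have h1 : s ^ (d - j) ≤ s ^ d := pow_le_pow_right₀ hs (Nat.sub_le _ _)
    have h2 : t ^ (d - i) ≤ t ^ d := pow_le_pow_right₀ ht (Nat.sub_le _ _)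
    exact mul_le_mul (mul_le_mul (hcoef i j) h1 (pow_nonneg hs0 _) hL0) h2 (pow_nonneg ht0 _)
      (mul_nonneg hL0 (pow_nonneg hs0 _))
  · rw [abs_zero]; exact mul_nonneg (mul_nonneg hL0 (pow_nonneg hs0 _)) (pow_nonneg ht0 _)

/-- The rescaled polynomial of a non-zero `F` (partial degrees `≤ d`, `s, t ≠ 0`) is non-zero. -/
theorem scaleXY_ne_zero (F : ℤ[X][X]) (hF : F ≠ 0) {s t : ℤ} (hs : s ≠ 0) (ht : t ≠ 0) {d : ℕ}
    (hdegy : F.natDegree ≤ d) (hdegx : ∀ i, (F.coeff i).natDegree ≤ d) : scaleXY F s t d ≠ 0 := by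
  intro h0
  set i : ℕ := F.natDegree with hi
  have hfi : F.coeff i ≠ 0 := by
    have := Polynomial.leadingCoeff_ne_zero.mpr hF
    rwa [Polynomial.leadingCoeff] at this
  set j : ℕ := (F.coeff i).natDegree with hj
  have hfij : (F.coeff i).coeff j ≠ 0 := by
    have := Polynomial.leadingCoeff_ne_zero.mpr hfi
    rwa [Polynomial.leadingCoeff] at this
  have hc := coeff_coeff_scaleXY F s t d i j
  rw [h0, coeff_zero, coeff_zero, if_pos ⟨hdegy, hdegx i⟩] at hc
  exact (mul_ne_zero (mul_ne_zero hfij (pow_ne_zero _ hs)) (pow_ne_zero _ ht)) hc.symm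

/-- **Rescaling identity:** `F̃(s x₀, t y₀) = s^d t^d F(x₀, y₀)`. -/
theorem evxy_scaleXY (F : ℤ[X][X]) (s t : ℤ) {d : ℕ} (hdegy : F.natDegree ≤ d)
    (hdegx : ∀ i, (F.coeff i).natDegree ≤ d) (x₀ y₀ : ℚ) :
    evxy ((s : ℚ) * x₀) ((t : ℚ) * y₀) (scaleXY F s t d) = (s : ℚ) ^ d * (t : ℚ) ^ d * evxy x₀ y₀ F := by
  rw [evxy_eq_sum_sum _ _ _ (natDegree_scaleXY_le F s t d) (natDegree_coeff_scaleXY_le F s t d),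
    evxy_eq_sum_sum _ _ _ hdegy hdegx, Finset.mul_sum]
  refine Finset.sum_congr rfl fun i hi => ?_
  rw [Finset.mul_sum]
  refine Finset.sum_congr rfl fun j hj => ?_
  have hi' : i ≤ d := by have := Finset.mem_range.mp hi; omega
  have hj' : j ≤ d := by have := Finset.mem_range.mp hj; omega
  rw [coeff_coeff_scaleXY, if_pos ⟨hi', hj'⟩]
  have e1 : (s : ℚ) ^ d = (s : ℚ) ^ (d - j) * (s : ℚ) ^ j := by rw [← pow_add, Nat.sub_add_cancel hj']
  have e2 : (t : ℚ) ^ d = (t : ℚ) ^ (d - i) * (t : ℚ) ^ i := by rw [← pow_add, Nat.sub_add_cancel hi']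
  push_cast
  rw [e1, e2, mul_pow, mul_pow]
  ring

/-- **The integer Taylor shift** `G(X, Y) = H(X + A, Y + B)` (`A, B ∈ ℤ`). -/
noncomputable def shiftXY (H : ℤ[X][X]) (A B : ℤ) : ℤ[X][X] :=
  (taylor (C B) H).map (taylorAlgHom A : ℤ[X] →ₐ[ℤ] ℤ[X]).toRingHom

/-- `G(x, y) = H(x + A, y + B)` at rational points. -/
theorem evxy_shiftXY (H : ℤ[X][X]) (A B : ℤ) (x y : ℚ) :
    evxy x y (shiftXY H A B) = evxy (x + A) (y + B) H := by
  unfold evxy shiftXY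
  rw [Polynomial.map_map]
  have hcomp : (Polynomial.aeval x : ℤ[X] →ₐ[ℤ] ℚ).toRingHom.comp
      (taylorAlgHom A : ℤ[X] →ₐ[ℤ] ℤ[X]).toRingHom =
      (Polynomial.aeval (x + (A : ℚ)) : ℤ[X] →ₐ[ℤ] ℚ).toRingHom := by
    refine Polynomial.ringHom_ext (fun a => ?_) ?_
    · simp
    · simp [taylor_X]
  rw [hcomp, map_taylor, taylor_eval]
  congr 1
  show y + Polynomial.aeval (x + (A : ℚ)) (C B) = y + B
  simp

/-- Coefficients of the shift: `G_b = taylor A ((taylor (C B) H)_b)`. -/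
theorem coeff_shiftXY (H : ℤ[X][X]) (A B : ℤ) (b : ℕ) :
    (shiftXY H A B).coeff b = taylor A ((taylor (C B) H).coeff b) := by
  unfold shiftXY
  rw [coeff_map]
  rfl

/-- The shift of a non-zero polynomial is non-zero. -/
theorem shiftXY_ne_zero (H : ℤ[X][X]) (hH : H ≠ 0) (A B : ℤ) : shiftXY H A B ≠ 0 := by
  intro h0
  apply hH
  have h1 : taylor (C B) H = 0 := by
    refine Polynomial.map_injective (taylorAlgHom A : ℤ[X] →ₐ[ℤ] ℤ[X]).toRingHom
      (fun p q hpq => taylor_injective A ?_) ?_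
    · exact hpq
    · rw [Polynomial.map_zero]; exact h0
  exact taylor_injective (C B) (by rw [h1, map_zero])

/-- Outer degree of the shift. -/
theorem natDegree_shiftXY_le (H : ℤ[X][X]) (A B : ℤ) {d : ℕ} (hdeg : H.natDegree ≤ d) :
    (shiftXY H A B).natDegree ≤ d := by
  unfold shiftXY
  exact (natDegree_map_le).trans ((natDegree_taylor _ _).le.trans hdeg)

/-- Inner degrees of the shift. -/
theorem natDegree_coeff_shiftXY_le (H : ℤ[X][X]) (A B : ℤ) {d : ℕ}
    (hdegx : ∀ i, (H.coeff i).natDegree ≤ d) (b : ℕ) : ((shiftXY H A B).coeff b).natDegree ≤ d := by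
  rw [coeff_shiftXY, natDegree_taylor]
  exact natDegree_coeff_taylor_C_le H hdegx B b

/-- **Height of the shift:** `|G_{ba}| ≤ (d+1)² 4^d α^d β^d L`. -/
theorem abs_coeff_coeff_shiftXY_le (H : ℤ[X][X]) {d : ℕ} (hdeg : H.natDegree ≤ d)
    (hdegx : ∀ i, (H.coeff i).natDegree ≤ d) {L : ℤ} (hcoef : ∀ i j, |(H.coeff i).coeff j| ≤ L)
    {A B α β : ℤ} (hA : |A| ≤ α) (hα : 1 ≤ α) (hB : |B| ≤ β) (hβ : 1 ≤ β) (b a : ℕ) :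
    |((shiftXY H A B).coeff b).coeff a| ≤ (d + 1) * 2 ^ d * α ^ d * ((d + 1) * 2 ^ d * β ^ d * L) := by
  rw [coeff_shiftXY]
  exact abs_coeff_taylor_le _ (natDegree_coeff_taylor_C_le H hdegx B b)
    (fun j => abs_coeff_coeff_taylor_C_le H hdeg hcoef hB hβ b j) hA hα a

end Taylor

end Summit.Schanuel.Schanuel.Theorems.RootDecomp1KOnePointCell
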